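import Summits.QuantumFields.YangMills.Theorems.UnitScaleTiltFluctuationComparisonRegPrPrintChiDescent
import Literature.MathematicalPhysics.QuantumFieldTheory.Balaban1983to89.T3OneStepAveragingPlaquettes
import HarnessLib

/-!
# `UnitScaleTiltFluctuationComparisonRegPrPrintChiDescentAdapter` — STUB 4′ of crux `FluctuationComparisonRegPrL` (stmt-QuantumFields-19935), (R1)/descent
# line, part 6: THE TOP-WINDOW INDICATOR FACTORS OUT OF THE RESTRICTED HEIGHT DENSITIES — so the descent sandwich of `…PrintChiDescent` (whose densities are
# restricted to `histGood K n`, top window INCLUDED) is fed by the cell's sockets at height `n+1` (which speak about `histGood K (n+1)`)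

Cell `ym3-torus`, width-lever lane `ym-ust-19935-r1`; card C6's support items S-b/S-c («`histGood` one-step factorisation», «naturality of `blockAvg` under
`fieldShift`») in the tree's currency.  Count-neutral helper (`--supports stmt-QuantumFields-19935`).  Pure measure theory / bookkeeping; no estimate asserted.

* §1 `resDensity_inter_preimage_ae` — for ANY measurable event `S` of run `K`'s fine fields and any measurable event `E` of its level-`k` fields:
  `ρ^{S ∩ (Ū^k)⁻¹E}_k = 1_E · ρ^S_k` a.e. (a constraint on the `k`-fold average is a constraint on the variable of `ρ_k`; test functions, `integral_resDensity_mul`,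
  uniqueness of densities).
* §2 `histGood_eq_inter_preimage_top` / `histGood_eq_inter_preimage_below` — `histGood K n = histGood K (n+1) ∩ {top window}`, the top window read at level `K − n`
  resp. (through one more averaging) at level `K − n − 1`.
* §3 `heightDensity_histGood_top_ae` — at the comparison height: `ρ^{histGood K n}_{(n)}(V) = [PlaqSmall θ(n) V]·ρ^{histGood K (n+1)}_{(n)}(V)` a.e.;
  `heightDensity_histGood_below_ae` — one level down: `ρ^{histGood K n}_{(n+1)}(W) = [PlaqSmall θ(n) (D_{n,n+1}W)]·ρ^{histGood K (n+1)}_{(n+1)}(W)` a.e. — the right-hand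
  density is the one the sockets `TwoSidedRepOn`/`PintCauchyOn` read at height `n+1`.
* §4 `sandwich_histGood_of_sandwich_succ` — consequently a two-run sandwich a.e. on a set `G` for the `histGood · (n+1)`-restricted densities at height `n+1` IS the
  sandwich for the `histGood · n`-restricted ones (hypothesis `hcmp` of `fourPrime_pair_of_descent`), the indicator being common to both runs.

References: T. Bałaban, CMP 102 (1985) 255–275 [Balaban1985UV3] ((2) p.256, (7) p.257, (41) p.266); CMP 109 (1987) 249–301 [Balaban1987RG1] ((0.11) p.253).
-/

noncomputable section

namespace Summit.QuantumFields.YangMills.Theorems.PrintChiDescent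

open MeasureTheory Filter Set
open Literature.MathematicalPhysics.QuantumFieldTheory.Balaban1983to89
open Literature.MathematicalPhysics.QuantumFieldTheory.Balaban1983to89.T3ContinuumYM3Torus
open Literature.MathematicalPhysics.QuantumFieldTheory.Balaban1983to89.T3LevelShift
open Literature.MathematicalPhysics.QuantumFieldTheory.Balaban1983to89.T3UnitLawDensityEML (ℰp measurableE_ℰp)
open Literature.MathematicalPhysics.QuantumFieldTheory.Balaban1983to89.T3UnitScaleTilt
open Literature.MathematicalPhysics.QuantumFieldTheory.Balaban1983to89.T3RestrictedUnitDensity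
open Literature.MathematicalPhysics.QuantumFieldTheory.Balaban1983to89.T3TiltDescent
open Literature.MathematicalPhysics.QuantumFieldTheory.Balaban1983to89.T3CruxEstimates
open Literature.MathematicalPhysics.QuantumFieldTheory.Balaban1983to89.T3OneStepAveragingPlaquettes
open Literature.MathematicalPhysics.QuantumFieldTheory.Balaban1983to89.Missing
open Literature.MathematicalPhysics.QuantumFieldTheory.Balaban1983to89.T4Continuum

/-! ## §1 A constraint on the `k`-fold average factors out of `ρ^S_k` -/

section Factor

variable (F : T3Family) {γ : ℝ}

/-- A set integral as an integral against the indicator (local helper). [folklore] -/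
private theorem setIntegral_eq_integral_mul_indicator {X : Type*} [MeasurableSpace X] (μ : Measure X) (f : X → ℝ) {s : Set X}
    (hs : MeasurableSet s) : ∫ x in s, f x ∂μ = ∫ x, f x * s.indicator (fun _ => (1 : ℝ)) x ∂μ := by
  rw [← integral_indicator hs]
  congr 1
  funext x
  by_cases hx : x ∈ s
  · simp [hx]
  · simp [hx]

/-- **A CONSTRAINT ON THE `k`-FOLD AVERAGE FACTORS OUT OF THE RESTRICTED DENSITY**: for run `K`, a measurable event `S` of fine fields and a measurable event `E`
of level-`k` fields, `ρ^{S ∩ (Ū^k)⁻¹E}_k = 1_E·ρ^S_k` almost everywhere (`γ ≥ 0`, `k ≤ m + K`).  Both sides have the same integral against every bounded test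
function by `integral_resDensity_mul` ((2)/(6) with a test function), hence agree a.e. [cite: Balaban1985UV3, (2) p.256 and (7) p.257] -/
theorem resDensity_inter_preimage_ae (hγ : 0 ≤ γ) (K : ℕ) {S : Set (GaugeField (F.P K) 0 (Matrix.specialUnitaryGroup (Fin 2) ℂ))}
    (hS : MeasurableSet S) {k : ℕ} (hk : k ≤ F.m + K) {E : Set (GaugeField (F.P K) k (Matrix.specialUnitaryGroup (Fin 2) ℂ))}
    (hE : MeasurableSet E) :
    resDensity F γ K (S ∩ (Averaging.iter (fun i => BlockAveraging.blockAvg (P := F.P K) (j := i) ℰp) k) ⁻¹' E) k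
      =ᵐ[fieldMeasure (F.P K) k (Matrix.specialUnitaryGroup (Fin 2) ℂ)] E.indicator (resDensity F γ K S k) := by
  have hι : Measurable (Averaging.iter (fun i => BlockAveraging.blockAvg (P := F.P K) (j := i) ℰp) k) :=
    measurable_iter _ (F.avgMeasurable_of_measurableE ℰp measurableE_ℰp K) k
  have hS' : MeasurableSet (S ∩ (Averaging.iter (fun i => BlockAveraging.blockAvg (P := F.P K) (j := i) ℰp) k) ⁻¹' E) :=
    hS.inter (hι hE)
  refine Integrable.ae_eq_of_forall_setIntegral_eq _ _ (integrable_resDensity F K hS' hγ hk)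
    ((integrable_resDensity F K hS hγ hk).indicator hE) fun s hs _ => ?_
  have hb : ∀ t : Set (GaugeField (F.P K) k (Matrix.specialUnitaryGroup (Fin 2) ℂ)),
      ∃ C : ℝ, ∀ V, |t.indicator (fun _ => (1 : ℝ)) V| ≤ C := fun t =>
    ⟨1, fun V => by by_cases hV : V ∈ t <;> simp [hV]⟩
  rw [setIntegral_eq_integral_mul_indicator _ _ hs, setIntegral_eq_integral_mul_indicator _ _ hs,
    integral_resDensity_mul F K hS' hγ hk _ (measurable_const.indicator hs) (hb s)]
  have hrhs : (fun V => E.indicator (resDensity F γ K S k) V * s.indicator (fun _ => (1 : ℝ)) V) =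
      fun V => resDensity F γ K S k V * (E ∩ s).indicator (fun _ => (1 : ℝ)) V := by
    funext V
    by_cases hVE : V ∈ E
    · by_cases hVs : V ∈ s
      · simp [hVE, hVs]
      · simp [hVE, hVs]
    · simp [hVE]
  rw [hrhs, integral_resDensity_mul F K hS hγ hk _ (measurable_const.indicator (hE.inter hs)) (hb (E ∩ s))]
  congr 1
  funext U
  set W := Averaging.iter (fun i => BlockAveraging.blockAvg (P := F.P K) (j := i) ℰp) k U with hW
  by_cases hUS : U ∈ S
  · by_cases hWE : W ∈ E
    · have h1 : U ∈ S ∩ (Averaging.iter (fun i => BlockAveraging.blockAvg (P := F.P K) (j := i) ℰp) k) ⁻¹' E := ⟨hUS, hWE⟩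
      by_cases hWs : W ∈ s
      · simp [Set.indicator_of_mem h1, Set.indicator_of_mem hUS, hWE, hWs]
      · simp [hWs, hWE]
    · have h1 : U ∉ S ∩ (Averaging.iter (fun i => BlockAveraging.blockAvg (P := F.P K) (j := i) ℰp) k) ⁻¹' E := fun h => hWE h.2
      simp [Set.indicator_of_notMem h1, hWE]
  · have h1 : U ∉ S ∩ (Averaging.iter (fun i => BlockAveraging.blockAvg (P := F.P K) (j := i) ℰp) k) ⁻¹' E := fun h => hUS h.1
    simp [Set.indicator_of_notMem h1, Set.indicator_of_notMem hUS]

end Factor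

/-! ## §2 The top window as a constraint on an average -/

section HistGood

variable (F : T3Family) (θ : ℕ → ℝ)

/-- `histGood K n = histGood K (n+1) ∩ (Ū^{K−n})⁻¹{PlaqSmall θ(n)}` (`n ≤ K`): the event with `n` free top steps is the one with `n+1` free top steps cut by the
window at the height `K − n`. [cite: Balaban1985UV3, (7) p.257] -/
theorem histGood_eq_inter_preimage_top {n K : ℕ} (h : n ≤ K) :
    histGood F ℰp θ K n = histGood F ℰp θ K (n + 1) ∩
      (Averaging.iter (fun i => BlockAveraging.blockAvg (P := F.P K) (j := i) ℰp) (K - n)) ⁻¹'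
        {W : GaugeField (F.P K) (K - n) (Matrix.specialUnitaryGroup (Fin 2) ℂ) | PlaqSmall (θ n) W} := by
  ext U
  simp only [histGood, Set.mem_setOf_eq, Set.mem_inter_iff, Set.mem_preimage]
  constructor
  · intro hU
    refine ⟨fun j hj => hU j (by omega), ?_⟩
    have hK := hU (K - n) (by omega)
    rwa [show K - (K - n) = n by omega] at hK
  · rintro ⟨hU, htop⟩ j hj
    by_cases hjK : j = K - n
    · subst hjK
      rwa [show K - (K - n) = n by omega]
    · exact hU j (by omega)

/-- The same with the top window read ONE LEVEL DOWN through one more averaging (`n + 1 ≤ K`): `Ū^{K−n} = avg ∘ Ū^{K−n−1}`.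
[cite: Balaban1985UV3, (7) p.257] -/
theorem histGood_eq_inter_preimage_below {n K : ℕ} (h : n + 1 ≤ K) :
    histGood F ℰp θ K n = histGood F ℰp θ K (n + 1) ∩
      (Averaging.iter (fun i => BlockAveraging.blockAvg (P := F.P K) (j := i) ℰp) (K - (n + 1))) ⁻¹'
        {W : GaugeField (F.P K) (K - (n + 1)) (Matrix.specialUnitaryGroup (Fin 2) ℂ) |
          PlaqSmall (θ n) ((BlockAveraging.blockAvg (P := F.P K) (j := K - (n + 1)) ℰp).avg W)} := by
  rw [histGood_eq_inter_preimage_top F θ (Nat.le_of_succ_le h)]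
  congr 1
  ext U
  simp only [Set.mem_preimage, Set.mem_setOf_eq]
  obtain ⟨j, hj⟩ : ∃ j, K - n = j + 1 ∧ K - (n + 1) = j := ⟨K - (n + 1), by omega, rfl⟩
  rw [hj.1, hj.2]
  rfl

end HistGood

/-! ## §3 The top-window indicator factors out of the restricted height densities -/

section Height

variable (F : T3Family) {γ : ℝ}

/-- **AT THE COMPARISON HEIGHT**: `ρ^{histGood K n}_{(n)} = 1_{PlaqSmall θ(n)}·ρ^{histGood K (n+1)}_{(n)}` a.e. on the height-`n` lattice (`n ≤ K`, `γ ≥ 0`).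
[cite: Balaban1985UV3, (7) p.257 and (41) p.266] -/
theorem heightDensity_histGood_top_ae (hγ : 0 ≤ γ) {n K : ℕ} (h : n ≤ K) (θ : ℕ → ℝ) :
    ∀ᵐ V ∂fieldMeasure (F.P n) 0 (Matrix.specialUnitaryGroup (Fin 2) ℂ),
      heightDensity F γ h (histGood F ℰp θ K n) V =
        {V' : GaugeField (F.P n) 0 (Matrix.specialUnitaryGroup (Fin 2) ℂ) | PlaqSmall (θ n) V'}.indicator
          (heightDensity F γ h (histGood F ℰp θ K (n + 1))) V := by
  have hE : MeasurableSet {W : GaugeField (F.P K) (K - n) (Matrix.specialUnitaryGroup (Fin 2) ℂ) | PlaqSmall (θ n) W} :=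
    measurableSet_plaqSmall _
  have hae := resDensity_inter_preimage_ae F hγ K (measurableSet_histGood F ℰp measurableE_ℰp θ K (n + 1)) (k := K - n) (by omega) hE
  rw [← histGood_eq_inter_preimage_top F θ h] at hae
  have hmp := measurePreserving_fieldShift (G := Matrix.specialUnitaryGroup (Fin 2) ℂ)
    (F.sitesPerDir_eq (m := F.m) (K := K) (j := K - n) (m' := F.m) (K' := n) (j' := 0) (by omega))
  filter_upwards [hmp.quasiMeasurePreserving.ae hae] with V hV
  have hiff := plaqSmall_fieldShift F
    (F.sitesPerDir_eq (m := F.m) (K := K) (j := K - n) (m' := F.m) (K' := n) (j' := 0) (by omega)) (θ n) V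
  unfold heightDensity
  rw [hV]
  by_cases hs : PlaqSmall (θ n) V
  · rw [Set.indicator_of_mem (hiff.mpr hs), Set.indicator_of_mem (show V ∈ {V' | PlaqSmall (θ n) V'} from hs)]
  · rw [Set.indicator_of_notMem (fun hmem => hs (hiff.mp hmem)),
      Set.indicator_of_notMem (show V ∉ {V' | PlaqSmall (θ n) V'} from hs)]

/-- **ONE LEVEL BELOW THE COMPARISON HEIGHT**: `ρ^{histGood K n}_{(n+1)}(W) = 1_{PlaqSmall θ(n) (D_{n,n+1}W)}·ρ^{histGood K (n+1)}_{(n+1)}(W)` for a.e. field `W` of the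
height-`(n+1)` lattice (`n + 1 ≤ K`, `γ ≥ 0`) — the right-hand density is the object of the cell's sockets at height `n+1`; the window of height `n` is read on the
COMMON one-step average `D_{n,n+1}W` (naturality of the averaging under the level identification, `blockAvg_fieldShift`). [cite: Balaban1987RG1, (0.11) p.253] -/
theorem heightDensity_histGood_below_ae (hγ : 0 ≤ γ) {n K : ℕ} (h : n + 1 ≤ K) (θ : ℕ → ℝ) :
    ∀ᵐ W ∂fieldMeasure (F.P (n + 1)) 0 (Matrix.specialUnitaryGroup (Fin 2) ℂ),
      heightDensity F γ h (histGood F ℰp θ K n) W =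
        {W' : GaugeField (F.P (n + 1)) 0 (Matrix.specialUnitaryGroup (Fin 2) ℂ) |
            PlaqSmall (θ n) (descendTo F ℰp n (n + 1) (Nat.le_succ n) W')}.indicator
          (heightDensity F γ h (histGood F ℰp θ K (n + 1))) W := by
  have hE : MeasurableSet {W : GaugeField (F.P K) (K - (n + 1)) (Matrix.specialUnitaryGroup (Fin 2) ℂ) |
      PlaqSmall (θ n) ((BlockAveraging.blockAvg (P := F.P K) (j := K - (n + 1)) ℰp).avg W)} :=
    measurableSet_plaqSmall _ |>.preimage (F.avgMeasurable_of_measurableE ℰp measurableE_ℰp K (K - (n + 1)))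
  have hae := resDensity_inter_preimage_ae F hγ K (measurableSet_histGood F ℰp measurableE_ℰp θ K (n + 1)) (k := K - (n + 1)) (by omega) hE
  rw [← histGood_eq_inter_preimage_below F θ h] at hae
  have hmp := measurePreserving_fieldShift (G := Matrix.specialUnitaryGroup (Fin 2) ℂ)
    (F.sitesPerDir_eq (m := F.m) (K := K) (j := K - (n + 1)) (m' := F.m) (K' := n + 1) (j' := 0) (by omega))
  filter_upwards [hmp.quasiMeasurePreserving.ae hae] with W hW
  -- the window of height `n` on the common one-step average
  have e1 := blockAvg_fieldShift ℰp
    (F.sitesPerDir_eq (m := F.m) (K := K) (j := K - (n + 1)) (m' := F.m) (K' := n + 1) (j' := 0) (by omega))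
    (F.sitesPerDir_eq (m := F.m) (K := K) (j := K - (n + 1) + 1) (m' := F.m) (K' := n + 1) (j' := 0 + 1) (by omega)) W
  have i1 := (Iff.of_eq (congrArg (PlaqSmall (θ n)) e1)).trans
    (plaqSmall_fieldShift F (F.sitesPerDir_eq (m := F.m) (K := K) (j := K - (n + 1) + 1) (m' := F.m) (K' := n + 1) (j' := 0 + 1) (by omega))
      (θ n) ((BlockAveraging.blockAvg (P := F.PP F.m (n + 1)) (j := 0) ℰp).avg W))
  have i2 := (Iff.of_eq (congrArg (PlaqSmall (θ n)) (descendTo_succ F ℰp n W))).trans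
    (plaqSmall_fieldShift F (F.sitesPerDir_eq (m := F.m) (K := n) (j := 0) (m' := F.m) (K' := n + 1) (j' := 1) (by omega))
      (θ n) ((BlockAveraging.blockAvg (P := F.PP F.m (n + 1)) (j := 0) ℰp).avg W))
  have key := i1.trans i2.symm
  unfold heightDensity
  rw [hW]
  by_cases hs : PlaqSmall (θ n) (descendTo F ℰp n (n + 1) (Nat.le_succ n) W)
  · rw [Set.indicator_of_mem (key.mpr hs),
      Set.indicator_of_mem (show W ∈ {W' | PlaqSmall (θ n) (descendTo F ℰp n (n + 1) (Nat.le_succ n) W')} from hs)]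
  · rw [Set.indicator_of_notMem (fun hmem => hs (key.mp hmem)),
      Set.indicator_of_notMem (show W ∉ {W' | PlaqSmall (θ n) (descendTo F ℰp n (n + 1) (Nat.le_succ n) W')} from hs)]

end Height

/-! ## §4 Feeding the descent sandwich from the height-`(n+1)` objects of the sockets -/

section Feed

variable (F : T3Family) {γ : ℝ}

/-- **THE SANDWICH HYPOTHESIS OF `fourPrime_pair_of_descent` FROM A SANDWICH OF THE SOCKETS' OBJECTS ONE LEVEL DOWN.**  If the `histGood · (n+1)`-restricted
height densities of runs `K` and `K+1` at height `n+1` (the objects `TwoSidedRepOn`/`PintCauchyOn` speak about at height `n+1`) satisfy the two-run sandwich a.e. on a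
set `G`, then so do the `histGood · n`-restricted ones (the objects of the descent sandwich): the extra top-window indicator `1_{PlaqSmall θ(n)(D_{n,n+1}W)}` is COMMON
to both runs (§3). [cite: King1986, Thm 3.4 (3.9) p.656] -/
theorem sandwich_histGood_of_sandwich_succ (hγ : 0 ≤ γ) {n K : ℕ} (h : n + 1 ≤ K) (θ : ℕ → ℝ)
    {G : Set (GaugeField (F.P (n + 1)) 0 (Matrix.specialUnitaryGroup (Fin 2) ℂ))} {κ r : ℝ}
    (hcmp : ∀ᵐ W ∂fieldMeasure (F.P (n + 1)) 0 (Matrix.specialUnitaryGroup (Fin 2) ℂ), W ∈ G →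
      Real.exp (κ - r) * heightDensity F γ h (histGood F ℰp θ K (n + 1)) W ≤
          heightDensity F γ (h.trans (Nat.le_succ K)) (histGood F ℰp θ (K + 1) (n + 1)) W ∧
        heightDensity F γ (h.trans (Nat.le_succ K)) (histGood F ℰp θ (K + 1) (n + 1)) W ≤
          Real.exp (κ + r) * heightDensity F γ h (histGood F ℰp θ K (n + 1)) W) :
    ∀ᵐ W ∂fieldMeasure (F.P (n + 1)) 0 (Matrix.specialUnitaryGroup (Fin 2) ℂ), W ∈ G →
      Real.exp (κ - r) * heightDensity F γ h (histGood F ℰp θ K n) W ≤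
          heightDensity F γ (h.trans (Nat.le_succ K)) (histGood F ℰp θ (K + 1) n) W ∧
        heightDensity F γ (h.trans (Nat.le_succ K)) (histGood F ℰp θ (K + 1) n) W ≤
          Real.exp (κ + r) * heightDensity F γ h (histGood F ℰp θ K n) W := by
  filter_upwards [hcmp, heightDensity_histGood_below_ae F hγ h θ, heightDensity_histGood_below_ae F hγ (h.trans (Nat.le_succ K)) θ]
    with W hW hA hB hWG
  rw [hA, hB]
  by_cases hs : PlaqSmall (θ n) (descendTo F ℰp n (n + 1) (Nat.le_succ n) W)
  · have hmem : W ∈ {W' : GaugeField (F.P (n + 1)) 0 (Matrix.specialUnitaryGroup (Fin 2) ℂ) |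
        PlaqSmall (θ n) (descendTo F ℰp n (n + 1) (Nat.le_succ n) W')} := hs
    rw [Set.indicator_of_mem hmem, Set.indicator_of_mem hmem]
    exact hW hWG
  · have hmem : W ∉ {W' : GaugeField (F.P (n + 1)) 0 (Matrix.specialUnitaryGroup (Fin 2) ℂ) |
        PlaqSmall (θ n) (descendTo F ℰp n (n + 1) (Nat.le_succ n) W')} := hs
    rw [Set.indicator_of_notMem hmem, Set.indicator_of_notMem hmem, mul_zero, mul_zero]
    exact ⟨le_rfl, le_rfl⟩

end Feed


end Summit.QuantumFields.YangMills.Theorems.PrintChiDescent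

end
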